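import Summits.SmoothPoincare4.SmoothPoincare4.Theses.EntropyRung
import Literature.Geometry.Lorentzian.CurvatureNaturality
import Literature.Geometry.Lorentzian.EndChartIntegral
import Literature.Geometry.Lorentzian.RiemannianVolumeIsometry
import Literature.Geometry.Lorentzian.IsometryProofs
import Literature.Geometry.Lorentzian.LeviCivitaProofs
import HarnessLib

/-!
# The entropy clause of `EntropyRung.SubcylindricalExistence` is a diffeomorphism invariant
(crux stmt-SmoothPoincare4-10871, line `curvature-dimension-entropy-floor`; companion of
`EntropyRungSubcylindricalExistenceTransport.lean`, which transports the ROUND witness)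

`SubcylindricalExistence` quantifies over every Hausdorff second-countable `M`, EVERY `C^∞` atlas on
it and every homotopy equivalence `M ≃ₕ S⁴`. This file proves that its per-manifold clause

  `ENT(M)`: `∃ g` Riemannian with Levi-Civita connection, `R_g > 0`, `∃ δ > 0, ∀ τ > 0, ∀ f` smooth,
  `∫ (4πτ)⁻² e^{−f} dV = 1 → ν_cyl + δ ≤ 𝒲(g, f, τ)`

depends only on the DIFFEOMORPHISM CLASS of `M`: for any diffeomorphism `Φ : M ≃ₘ⟮𝓡 4, 𝓡 4⟯ N`,
`ENT(N) → ENT(M)` (`subcylindricalClause_of_diffeomorph_of_clause`). The witness on `M` is the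
pullback `Φ^* g` of the witness on `N` (`PseudoRiemannianMetric.comap`, `contMDiff_pullbackBilin_holds`),
with the same `δ`: a test function `f` on `M` is read on `N` as `f ∘ Φ⁻¹`; the scalar curvature is
natural (`scalarCurvature_comap`), the gradient square is natural (`innerDual_mvfderiv_comp`), and
`Φ` is measure preserving for the two Riemannian measures (`IsIsometry.measurePreserving_riemannianMeasure`),
so both the normalisation and the value of `𝒲` are transported by the change of variables
(`MeasurePreserving.integral_comp`). In particular the crux is a statement about smooth structures on
the 4-sphere up to diffeomorphism, and ANY witness on ANY `N ≅ S⁴` (not only the round metric)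
transfers to every `M` diffeomorphic to it. Everything is proved; no definition, no named fact.

References: [ONeill1983] Ch. 3, Prop. 3.59; [Federer1969] §2.10.11; [Perelman2002Entropy] §3.1
(diffeomorphism invariance of `𝒲`).
-/

noncomputable section

-- the registered namespace `Summit.SmoothPoincare4.SmoothPoincare4.Theorems` repeats a component
set_option linter.dupNamespace false

open scoped Manifold ContDiff Topology ENNReal NNReal ContinuousMap
open Set MeasureTheory
open Literature.Geometry.Lorentzian

namespace Summit.SmoothPoincare4.SmoothPoincare4.Theorems

section Invariance

variable {M : Type} [TopologicalSpace M] [ChartedSpace (EuclideanSpace ℝ (Fin 4)) M]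
  [IsManifold (𝓡 4) ∞ M] [T3Space M] [MeasurableSpace M] [BorelSpace M]
  {N : Type} [TopologicalSpace N] [ChartedSpace (EuclideanSpace ℝ (Fin 4)) N]
  [IsManifold (𝓡 4) ∞ N] [T3Space N] [MeasurableSpace N] [BorelSpace N]

omit [IsManifold (𝓡 4) ∞ M] [T3Space M] [MeasurableSpace M] [BorelSpace M]
  [IsManifold (𝓡 4) ∞ N] [T3Space N] [MeasurableSpace N] [BorelSpace N] in
/-- The differentials of a `C^∞` diffeomorphism between 4-manifolds are injective. [folklore] -/
theorem mfderiv_injective_of_diffeomorph_four (Φ : Diffeomorph (𝓡 4) (𝓡 4) M N ∞) (x : M) :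
    Function.Injective (mfderiv (𝓡 4) (𝓡 4) Φ x) :=
  (Φ.mfderivToContinuousLinearEquiv (by simp) x).injective

/-- **Pulling a Riemannian metric back along a diffeomorphism of 4-manifolds**: for
`Φ : M ≃ₘ N` and a `C^∞` Riemannian `gN` on `N` (with Levi-Civita connection) there is a `C^∞`
Riemannian `gM` on `M` with Levi-Civita connection — the pullback `Φ^* gN` — such that
(i) `R_{gM}(x) = R_{gN}(Φ x)` (`scalarCurvature_comap`), (ii) `|∇(w ∘ Φ)|²_{gM}(x) = |∇w|²_{gN}(Φ x)`
for every `w` differentiable at `Φ x` (`innerDual_mvfderiv_comp`), and (iii) `Φ` is measure preserving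
from `dV_{gM}` to `dV_{gN}` (`IsIsometry.measurePreserving_riemannianMeasure`).
[cite: ONeill1983, Ch. 3, Prop. 3.59] -/
theorem exists_comap_of_diffeomorph (Φ : Diffeomorph (𝓡 4) (𝓡 4) M N ∞)
    (gN : PseudoRiemannianMetric (𝓡 4) ∞ (EuclideanSpace ℝ (Fin 4)) (TangentSpace (𝓡 4) : N → Type _))
    [gN.HasLeviCivita] (hgN : gN.IsRiemannian) :
    ∃ gM : PseudoRiemannianMetric (𝓡 4) ∞ (EuclideanSpace ℝ (Fin 4)) (TangentSpace (𝓡 4) : M → Type _),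
    ∃ _ : gM.HasLeviCivita, ∃ hgM : gM.IsRiemannian,
      (∀ x : M, gM.scalarCurvature x = gN.scalarCurvature (Φ x)) ∧
      (∀ (w : N → ℝ) (x : M), MDifferentiableAt (𝓡 4) 𝓘(ℝ, ℝ) w (Φ x) →
        gM.gradSq (w ∘ Φ) x = gN.gradSq w (Φ x)) ∧
      MeasurePreserving Φ (riemannianMeasure (gM.toContMDiffRiemannianMetric hgM))
        (riemannianMeasure (gN.toContMDiffRiemannianMetric hgN)) := by
  set gM : PseudoRiemannianMetric (𝓡 4) ∞ (EuclideanSpace ℝ (Fin 4)) (TangentSpace (𝓡 4) : M → Type _) :=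
    gN.comap PseudoRiemannianMetric.contMDiff_pullbackBilin_holds Φ Φ.contMDiff
      (mfderiv_injective_of_diffeomorph_four Φ) rfl with hgMdef
  have hiso : PseudoRiemannianMetric.IsIsometry gM gN Φ := fun _ ↦ rfl
  have hgM : gM.IsRiemannian := hiso.isRiemannian (by simp) hgN
  haveI : gM.HasLeviCivita := gM.hasLeviCivita
  refine ⟨gM, ‹_›, hgM, fun x ↦ ?_, fun w x hw ↦ ?_, hiso.measurePreserving_riemannianMeasure (by simp) hgM hgN⟩
  · exact PseudoRiemannianMetric.scalarCurvature_comap gN PseudoRiemannianMetric.contMDiff_pullbackBilin_holds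
      Φ.contMDiff (mfderiv_injective_of_diffeomorph_four Φ) rfl x
  · exact PseudoRiemannianMetric.innerDual_mvfderiv_comp gN PseudoRiemannianMetric.contMDiff_pullbackBilin_holds
      Φ.contMDiff (mfderiv_injective_of_diffeomorph_four Φ) rfl x hw hw

end Invariance

/-- **The entropy clause of the crux is a diffeomorphism invariant.** If `Φ : M ≃ₘ N` is a `C^∞`
diffeomorphism of 4-manifolds (any atlases) and `N` carries a Riemannian `g` with Levi-Civita
connection, `R_g > 0` and `∃ δ > 0, ∀ τ > 0, ∀ f` smooth with `∫ (4πτ)⁻² e^{−f} dV = 1`,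
`ν_cyl + δ ≤ 𝒲(g, f, τ)` (the clause `ENT(N)` of `EntropyRung.SubcylindricalExistence`), then so does
`M`, with the pullback metric `Φ^* g` and the SAME `δ`: a test function `f` on `M` is the test function
`f ∘ Φ⁻¹` on `N`, `R`, `|∇·|²` and `dV` being natural under the isometry `Φ`
(`exists_comap_of_diffeomorph`) and the integrals transported by `MeasurePreserving.integral_comp`.
[cite: Perelman2002Entropy, §3.1] -/
theorem subcylindricalClause_of_diffeomorph_of_clause :
    ∀ (M : Type) [TopologicalSpace M] [ChartedSpace (EuclideanSpace ℝ (Fin 4)) M] [IsManifold (𝓡 4) ∞ M]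
      [T3Space M] [MeasurableSpace M] [BorelSpace M]
      (N : Type) [TopologicalSpace N] [ChartedSpace (EuclideanSpace ℝ (Fin 4)) N] [IsManifold (𝓡 4) ∞ N]
      [T3Space N] [MeasurableSpace N] [BorelSpace N]
      (Φ : Diffeomorph (𝓡 4) (𝓡 4) M N ∞) (c : ℝ),
      (∃ g : PseudoRiemannianMetric (𝓡 4) ∞ (EuclideanSpace ℝ (Fin 4)) (TangentSpace (𝓡 4) : N → Type _),
        ∃ _ : g.HasLeviCivita, ∃ hg : g.IsRiemannian, (∀ y : N, 0 < g.scalarCurvature y) ∧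
          ∃ δ : ℝ, 0 < δ ∧ ∀ τ : ℝ, 0 < τ → ∀ f : N → ℝ, ContMDiff (𝓡 4) 𝓘(ℝ, ℝ) ∞ f →
            ∫ y, (4 * Real.pi * τ) ^ (-(4 : ℝ) / 2) * Real.exp (-f y)
              ∂(riemannianMeasure (g.toContMDiffRiemannianMetric hg)) = 1 →
            c + δ ≤
              ∫ y, (τ * (g.scalarCurvature y + g.gradSq f y) + f y - 4) *
                ((4 * Real.pi * τ) ^ (-(4 : ℝ) / 2) * Real.exp (-f y))
                ∂(riemannianMeasure (g.toContMDiffRiemannianMetric hg))) →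
      ∃ g : PseudoRiemannianMetric (𝓡 4) ∞ (EuclideanSpace ℝ (Fin 4)) (TangentSpace (𝓡 4) : M → Type _),
        ∃ _ : g.HasLeviCivita, ∃ hg : g.IsRiemannian, (∀ x : M, 0 < g.scalarCurvature x) ∧
          ∃ δ : ℝ, 0 < δ ∧ ∀ τ : ℝ, 0 < τ → ∀ f : M → ℝ, ContMDiff (𝓡 4) 𝓘(ℝ, ℝ) ∞ f →
            ∫ x, (4 * Real.pi * τ) ^ (-(4 : ℝ) / 2) * Real.exp (-f x)
              ∂(riemannianMeasure (g.toContMDiffRiemannianMetric hg)) = 1 →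
            c + δ ≤
              ∫ x, (τ * (g.scalarCurvature x + g.gradSq f x) + f x - 4) *
                ((4 * Real.pi * τ) ^ (-(4 : ℝ) / 2) * Real.exp (-f x))
                ∂(riemannianMeasure (g.toContMDiffRiemannianMetric hg)) := by
  intro M _ _ _ _ _ _ N _ _ _ _ _ _ Φ c hN
  obtain ⟨gN, hLCN, hgN, hRN, δ, hδ, hWN⟩ := hN
  obtain ⟨gM, hLCM, hgM, hR, hgrad, hmp⟩ := exists_comap_of_diffeomorph Φ gN hgN
  have hme : MeasurableEmbedding Φ := Φ.toHomeomorph.measurableEmbedding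
  refine ⟨gM, hLCM, hgM, fun x ↦ (hR x).symm ▸ hRN (Φ x), δ, hδ, fun τ hτ f hf hnorm ↦ ?_⟩
  -- read the test function on `N`
  set f' : N → ℝ := f ∘ Φ.symm with hf'def
  have hf' : ContMDiff (𝓡 4) 𝓘(ℝ, ℝ) ∞ f' := hf.comp Φ.symm.contMDiff
  have hff' : ∀ x : M, f' (Φ x) = f x := fun x ↦ by simp [hf'def]
  have hfcomp : f' ∘ Φ = f := funext hff'
  -- normalisation on `N` by change of variables
  have hnormN : ∫ y, (4 * Real.pi * τ) ^ (-(4 : ℝ) / 2) * Real.exp (-f' y)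
      ∂(riemannianMeasure (gN.toContMDiffRiemannianMetric hgN)) = 1 := by
    rw [← hmp.integral_comp hme (fun y ↦ (4 * Real.pi * τ) ^ (-(4 : ℝ) / 2) * Real.exp (-f' y))]
    simpa only [hff'] using hnorm
  have hW := hWN τ hτ f' hf' hnormN
  -- the value of `𝒲` by change of variables and naturality of `R`, `|∇·|²`
  rw [← hmp.integral_comp hme (fun y ↦ (τ * (gN.scalarCurvature y + gN.gradSq f' y) + f' y - 4) *
      ((4 * Real.pi * τ) ^ (-(4 : ℝ) / 2) * Real.exp (-f' y)))] at hW
  have hpt : ∀ x : M, (τ * (gN.scalarCurvature (Φ x) + gN.gradSq f' (Φ x)) + f' (Φ x) - 4) *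
        ((4 * Real.pi * τ) ^ (-(4 : ℝ) / 2) * Real.exp (-f' (Φ x))) =
      (τ * (gM.scalarCurvature x + gM.gradSq f x) + f x - 4) *
        ((4 * Real.pi * τ) ^ (-(4 : ℝ) / 2) * Real.exp (-f x)) := by
    intro x
    have hdf' : MDifferentiableAt (𝓡 4) 𝓘(ℝ, ℝ) f' (Φ x) := (hf' (Φ x)).mdifferentiableAt (by simp)
    rw [hR x, ← hgrad f' x hdf', hfcomp, hff']
  simp only [hpt] at hW
  exact hW


end Summit.SmoothPoincare4.SmoothPoincare4.Theorems

end
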